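import Mathlib

/-!
# Crux `HilbertIntegralOverconvergentIsCongruence` (stmt-Langlands-8485), line `Sketch-ideate-r1-k1`:
# group-theoretic glue of the TRANSFER half (`csp-koecher-collapse`)

The transfer `C⁺ ⇒ crux` of the line reads: if the standard-cusp `q`-expansion `g` is ALGEBRAIC over
the Hilbert modular function field `K = E(X₁(𝔫))`, then `Γ₁(𝔫)` — acting on the field of meromorphic
functions by automorphisms fixing `K` pointwise — permutes the finitely many roots of the minimal
polynomial of `g`, so the stabiliser of `g` has finite index; by Serre's congruence subgroup property it
contains a principal congruence subgroup, and Götzky–Koecher makes `g` classical.  This file proves the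
purely algebraic first step in full generality (any group acting on a field by automorphisms over a
subfield; any element algebraic over the subfield):

* `orbit_subset_rootSet_minpoly` — the orbit of an integral element lies in the root set of its minimal
  polynomial;
* `finite_orbit_of_isAlgebraic`, `finiteIndex_stabilizer_of_isAlgebraic` — hence the orbit is finite
  and the stabiliser has finite index;
* `finiteIndex_stabilizer_of_finite_orbit` — the orbit–stabiliser step used (verbatim the skeleton's
  glue lemma).

Mathlib only; theorems only.
-/

set_option linter.dupNamespace false -- mandated namespace `Summit.Langlands.Langlands.…` repeats a component

namespace Summit.Langlands.Langlands.Theorems.HilbertIntegralOverconvergentIsCongruence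

/-- Orbit–stabiliser: an element with FINITE orbit under a group action has a stabiliser of finite
index (the index of the stabiliser is the cardinality of the orbit). [folklore] -/
theorem finiteIndex_stabilizer_of_finite_orbit {G X : Type*} [Group G] [MulAction G X] (x : X)
    (h : (MulAction.orbit G x).Finite) : (MulAction.stabilizer G x).FiniteIndex := by
  rw [Subgroup.finiteIndex_iff, MulAction.index_stabilizer]
  exact ((Set.ncard_pos h).mpr ⟨x, MulAction.mem_orbit_self x⟩).ne'

variable {G K L : Type*} [Group G] [Field K] [Field L] [Algebra K L] [MulSemiringAction G L]
  [SMulCommClass G K L]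

/-- If a group `G` acts on a field `L` by ring automorphisms commuting with the scalar action of a
subfield `K` (i.e. by `K`-algebra automorphisms), the `G`-orbit of an element `x ∈ L` integral over
`K` is contained in the (finite) set of roots in `L` of the minimal polynomial of `x`. [folklore] -/
theorem orbit_subset_rootSet_minpoly (x : L) (hx : IsIntegral K x) :
    MulAction.orbit G x ⊆ (minpoly K x).rootSet L := by
  rintro _ ⟨g, rfl⟩
  rw [Polynomial.mem_rootSet_of_ne (minpoly.ne_zero hx)]
  have h := minpoly.aeval K x
  apply_fun (MulSemiringAction.toAlgEquiv K L g) at h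
  rwa [map_zero, ← Polynomial.aeval_algHom_apply] at h

/-- The `G`-orbit of an element algebraic over the fixed subfield `K` is finite. [folklore] -/
theorem finite_orbit_of_isAlgebraic (x : L) (hx : IsAlgebraic K x) :
    (MulAction.orbit G x).Finite :=
  (Polynomial.rootSet_finite _ _).subset (orbit_subset_rootSet_minpoly x hx.isIntegral)

/-- **The stabiliser of an algebraic element has finite index.**  If `G` acts on a field `L` by
`K`-algebra automorphisms and `x ∈ L` is algebraic over `K`, then `Stab_G(x)` has finite index in `G`
(applied in the line to `Γ₁(𝔫)` acting on meromorphic functions on `ℍ^d` over the Hilbert modular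
function field, and `x = g` the algebraic `q`-expansion). [folklore] -/
theorem finiteIndex_stabilizer_of_isAlgebraic (x : L) (hx : IsAlgebraic K x) :
    (MulAction.stabilizer G x).FiniteIndex :=
  finiteIndex_stabilizer_of_finite_orbit x (finite_orbit_of_isAlgebraic x hx)

end Summit.Langlands.Langlands.Theorems.HilbertIntegralOverconvergentIsCongruence
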